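import Summits.QuantumFields.YangMills.Theorems.AtomicCalibrationRPairCutoff
import Summits.QuantumFields.YangMills.Theorems.AtomicCalibrationRPairCutoffDeriv
import Summits.QuantumFields.YangMills.Theorems.AtomicCalibrationRGevreyProduct

/-!
# AtomicCalibrationR (stmt-QuantumFields-28169), E2 `stub_offDiagonalWhitney` — budget-free (Gevrey) rates of the pair cut-offs
# (roadmap v3 item G.3, second instance; prover w4 g22, free hands)

`PairCutoffProduct.exists_pairCut_rate` produces a compactness constant `C'(N)`; with the budget `N = N'·n` of `WhitneyPkg` that
constant is uncontrolled.  Under an explicit Gevrey bound on the step, `‖ψ^{(i)}‖ ≤ C₀ C₁^i (i!)^s` (`C₀, C₁ ≥ 1`, `|ψ| ≤ 1`,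
`ψ = 1` on `[4,∞)`), all orders are controlled with budget-independent constants:

* `norm_iteratedFDeriv_pairFactor_le_gevrey` — `‖D^i (z ↦ ψ(4^k‖z_l − z_{l'}‖²))‖ ≤ (i!)^{s+1} (8 C₀ C₁ 2^k)^i` (all `i`);
* `norm_iteratedFDeriv_pairCut_le_gevrey` — `‖D^i (∏_{l≠l'} ψ(4^k‖z_l − z_{l'}‖²))‖ ≤ (i!)^{s+1} (n² · 8 C₀ C₁ 2^k)^i` (all `i`);
  with `ψ := PairCutoff.stepψ` the product is `pairCut n k` by `rfl`.

No stub/crux/rung/summit is closed; nothing here touches Yang–Mills; the YM mass gap is NOT proved. [folklore]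
-/

set_option autoImplicit false

noncomputable section

open scoped BigOperators ContDiff
open Set Filter
open Summit.QuantumFields.YangMills.Cruxes.AtomicCalibrationR.PairCutoff (pairs)
open Summit.QuantumFields.YangMills.Cruxes.AtomicCalibrationR.PairCutoffDeriv (norm_iteratedFDeriv_inner_le)
open Summit.QuantumFields.YangMills.Cruxes.AtomicCalibrationR.GevreyProduct (norm_iteratedFDeriv_prod_le_factorial_pow)

namespace Summit.QuantumFields.YangMills.Cruxes.AtomicCalibrationR.GevreyPairCutoff

variable {n : ℕ}

/-- **Gevrey rate of a pair factor**, all orders. [folklore] -/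
theorem norm_iteratedFDeriv_pairFactor_le_gevrey {ψ : ℝ → ℝ} (hψ : ContDiff ℝ ∞ ψ) (h1 : ∀ x, 4 ≤ x → ψ x = 1)
    (hψ1 : ∀ x : ℝ, ‖ψ x‖ ≤ 1) {C₀ C₁ : ℝ} (hC₀ : 1 ≤ C₀) (hC₁ : 1 ≤ C₁) {s : ℕ}
    (hC : ∀ (i : ℕ) (t : ℝ), ‖iteratedFDeriv ℝ i ψ t‖ ≤ C₀ * C₁ ^ i * ((Nat.factorial i : ℕ) : ℝ) ^ s)
    (k : ℕ) (l l' : Fin n) (i : ℕ) (z : Fin n → EuclideanSpace ℝ (Fin 4)) :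
    ‖iteratedFDeriv ℝ i (fun z : Fin n → EuclideanSpace ℝ (Fin 4) => ψ ((4 : ℝ) ^ k * ‖z l - z l'‖ ^ 2)) z‖ ≤
      ((Nat.factorial i : ℕ) : ℝ) ^ (s + 1) * (8 * C₀ * C₁ * (2 : ℝ) ^ k) ^ i := by
  have hC₀0 : 0 ≤ C₀ := by linarith
  have hC₁0 : 0 ≤ C₁ := by linarith
  rcases Nat.eq_zero_or_pos i with rfl | hipos
  · rw [norm_iteratedFDeriv_zero, pow_zero, Nat.factorial_zero, Nat.cast_one, one_pow, mul_one]; exact hψ1 _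
  have hg : ContDiff ℝ ∞ (fun z : Fin n → EuclideanSpace ℝ (Fin 4) => (4 : ℝ) ^ k * ‖z l - z l'‖ ^ 2) := by
    have : ContDiff ℝ ∞ (fun z : Fin n → EuclideanSpace ℝ (Fin 4) => z l - z l') :=
      (contDiff_apply ℝ (EuclideanSpace ℝ (Fin 4)) l).sub (contDiff_apply ℝ (EuclideanSpace ℝ (Fin 4)) l')
    exact contDiff_const.mul (this.norm_sq ℝ)
  have hfun : (fun z : Fin n → EuclideanSpace ℝ (Fin 4) => ψ ((4 : ℝ) ^ k * ‖z l - z l'‖ ^ 2)) =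
      ψ ∘ (fun z : Fin n → EuclideanSpace ℝ (Fin 4) => (4 : ℝ) ^ k * ‖z l - z l'‖ ^ 2) := rfl
  have hRHS0 : 0 ≤ ((Nat.factorial i : ℕ) : ℝ) ^ (s + 1) * (8 * C₀ * C₁ * (2 : ℝ) ^ k) ^ i := by positivity
  by_cases hnear : ‖z l - z l'‖ ≤ 2 * (2 : ℝ)⁻¹ ^ k
  · -- near pair: Faà di Bruno with the uniform constant `C₀ C₁^i (i!)^s` for all orders `≤ i`
    rw [hfun]
    have hCunif : ∀ j : ℕ, j ≤ i → ∀ t : ℝ,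
        ‖iteratedFDeriv ℝ j ψ t‖ ≤ C₀ * C₁ ^ i * ((Nat.factorial i : ℕ) : ℝ) ^ s := by
      intro j hj t
      refine (hC j t).trans ?_
      have h1' : C₁ ^ j ≤ C₁ ^ i := pow_le_pow_right₀ hC₁ hj
      have h2' : ((Nat.factorial j : ℕ) : ℝ) ^ s ≤ ((Nat.factorial i : ℕ) : ℝ) ^ s :=
        pow_le_pow_left₀ (by positivity) (by exact_mod_cast Nat.factorial_le hj) s
      exact mul_le_mul (mul_le_mul_of_nonneg_left h1' hC₀0) h2' (by positivity) (by positivity)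
    have hcomp := norm_iteratedFDeriv_comp_le (𝕜 := ℝ) (N := (⊤ : ℕ∞)) hψ hg (n := i) (by exact_mod_cast le_top) z
      (C := C₀ * C₁ ^ i * ((Nat.factorial i : ℕ) : ℝ) ^ s) (D := 8 * (2 : ℝ) ^ k) (fun j hj => hCunif j hj _)
      (fun j hj _ => norm_iteratedFDeriv_inner_le k l l' hnear hj)
    refine hcomp.trans ?_
    have hC₀i : C₀ ≤ C₀ ^ i := le_self_pow₀ hC₀ (by omega)
    have hD0 : 0 ≤ (8 * (2 : ℝ) ^ k) ^ i := by positivity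
    calc ((Nat.factorial i : ℕ) : ℝ) * (C₀ * C₁ ^ i * ((Nat.factorial i : ℕ) : ℝ) ^ s) * (8 * (2 : ℝ) ^ k) ^ i
        ≤ ((Nat.factorial i : ℕ) : ℝ) * (C₀ ^ i * C₁ ^ i * ((Nat.factorial i : ℕ) : ℝ) ^ s) * (8 * (2 : ℝ) ^ k) ^ i := by
          refine mul_le_mul_of_nonneg_right (mul_le_mul_of_nonneg_left ?_ (by positivity)) hD0
          exact mul_le_mul_of_nonneg_right (mul_le_mul_of_nonneg_right hC₀i (by positivity)) (by positivity)
      _ = ((Nat.factorial i : ℕ) : ℝ) ^ (s + 1) * (8 * C₀ * C₁ * (2 : ℝ) ^ k) ^ i := by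
          rw [pow_succ, mul_pow, mul_pow, mul_pow]; ring
  · -- far pair: locally constant `1`
    rw [not_le] at hnear
    have hopen : IsOpen {w : Fin n → EuclideanSpace ℝ (Fin 4) | 2 * (2 : ℝ)⁻¹ ^ k < ‖w l - w l'‖} :=
      isOpen_lt continuous_const (by fun_prop)
    have hev : (fun z : Fin n → EuclideanSpace ℝ (Fin 4) => ψ ((4 : ℝ) ^ k * ‖z l - z l'‖ ^ 2)) =ᶠ[nhds z]
        fun _ => (1 : ℝ) := by
      filter_upwards [hopen.mem_nhds hnear] with w hw
      refine h1 _ ?_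
      have h0 : 0 ≤ 2 * (2 : ℝ)⁻¹ ^ k := by positivity
      have hsq : (2 * (2 : ℝ)⁻¹ ^ k) ^ 2 ≤ ‖w l - w l'‖ ^ 2 := pow_le_pow_left₀ h0 (le_of_lt hw) 2
      have hkey : (4 : ℝ) ^ k * (2 * (2 : ℝ)⁻¹ ^ k) ^ 2 = 4 := by
        rw [mul_pow, ← pow_mul, show (4 : ℝ) = 2 ^ 2 by norm_num, ← pow_mul, inv_pow, mul_comm 2 k]
        field_simp
      calc (4 : ℝ) = (4 : ℝ) ^ k * (2 * (2 : ℝ)⁻¹ ^ k) ^ 2 := hkey.symm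
        _ ≤ (4 : ℝ) ^ k * ‖w l - w l'‖ ^ 2 := mul_le_mul_of_nonneg_left hsq (by positivity)
    rw [(hev.iteratedFDeriv ℝ i).eq_of_nhds, iteratedFDeriv_const_of_ne (by omega), Pi.zero_apply, norm_zero]
    exact hRHS0

/-- **Gevrey rate of the pair cut-off**, all orders: `‖D^i (∏_{l≠l'} ψ(4^k‖z_l − z_{l'}‖²))(z)‖ ≤ (i!)^{s+1} (n²·8C₀C₁2^k)^i`.
With `ψ := PairCutoff.stepψ` the product is `PairCutoff.pairCut n k` (by `rfl`). [folklore] -/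
theorem norm_iteratedFDeriv_pairCut_le_gevrey {ψ : ℝ → ℝ} (hψ : ContDiff ℝ ∞ ψ) (h1 : ∀ x, 4 ≤ x → ψ x = 1)
    (hψ1 : ∀ x : ℝ, ‖ψ x‖ ≤ 1) {C₀ C₁ : ℝ} (hC₀ : 1 ≤ C₀) (hC₁ : 1 ≤ C₁) {s : ℕ}
    (hC : ∀ (i : ℕ) (t : ℝ), ‖iteratedFDeriv ℝ i ψ t‖ ≤ C₀ * C₁ ^ i * ((Nat.factorial i : ℕ) : ℝ) ^ s)
    (n k i : ℕ) (z : Fin n → EuclideanSpace ℝ (Fin 4)) :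
    ‖iteratedFDeriv ℝ i (fun z : Fin n → EuclideanSpace ℝ (Fin 4) =>
        ∏ p ∈ pairs n, ψ ((4 : ℝ) ^ k * ‖z p.1 - z p.2‖ ^ 2)) z‖ ≤
      ((Nat.factorial i : ℕ) : ℝ) ^ (s + 1) * ((n : ℝ) ^ 2 * (8 * C₀ * C₁ * (2 : ℝ) ^ k)) ^ i := by
  classical
  have hC₀0 : 0 ≤ C₀ := by linarith
  have hC₁0 : 0 ≤ C₁ := by linarith
  have hf : ∀ p ∈ pairs n, ContDiff ℝ ∞ (fun z : Fin n → EuclideanSpace ℝ (Fin 4) =>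
      ψ ((4 : ℝ) ^ k * ‖z p.1 - z p.2‖ ^ 2)) := by
    intro p _
    have hq : ContDiff ℝ ∞ (fun z : Fin n → EuclideanSpace ℝ (Fin 4) => z p.1 - z p.2) :=
      (contDiff_apply ℝ (EuclideanSpace ℝ (Fin 4)) p.1).sub (contDiff_apply ℝ (EuclideanSpace ℝ (Fin 4)) p.2)
    exact hψ.comp (contDiff_const.mul (hq.norm_sq ℝ))
  have hb : ∀ p ∈ pairs n, ∀ j : ℕ, j ≤ i → ‖iteratedFDeriv ℝ j (fun z : Fin n → EuclideanSpace ℝ (Fin 4) =>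
      ψ ((4 : ℝ) ^ k * ‖z p.1 - z p.2‖ ^ 2)) z‖ ≤ ((Nat.factorial j : ℕ) : ℝ) ^ (s + 1) * (8 * C₀ * C₁ * (2 : ℝ) ^ k) ^ j :=
    fun p _ j _ => norm_iteratedFDeriv_pairFactor_le_gevrey hψ h1 hψ1 hC₀ hC₁ hC k p.1 p.2 j z
  have hprod := norm_iteratedFDeriv_prod_le_factorial_pow (E := Fin n → EuclideanSpace ℝ (Fin 4)) (pairs n)
    (fun (p : Fin n × Fin n) (z : Fin n → EuclideanSpace ℝ (Fin 4)) => ψ ((4 : ℝ) ^ k * ‖z p.1 - z p.2‖ ^ 2)) hf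
    (M := 8 * C₀ * C₁ * (2 : ℝ) ^ k) (by positivity) (s + 1) i z hb
  refine hprod.trans (mul_le_mul_of_nonneg_left (pow_le_pow_left₀ (by positivity) ?_ i) (by positivity))
  have hcard : ((pairs n).card : ℝ) ≤ (n : ℝ) ^ 2 := by
    have : (pairs n).card ≤ n ^ 2 := by
      calc (pairs n).card ≤ (Finset.univ : Finset (Fin n × Fin n)).card := Finset.card_filter_le _ _
        _ = n ^ 2 := by rw [Finset.card_univ, Fintype.card_prod, Fintype.card_fin, sq]
    exact_mod_cast this
  exact mul_le_mul_of_nonneg_right hcard (by positivity)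

end Summit.QuantumFields.YangMills.Cruxes.AtomicCalibrationR.GevreyPairCutoff

end
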